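import Literature.MathematicalPhysics.QuantumFieldTheory.OSContinuationBounds
import Literature.MathematicalPhysics.QuantumFieldTheory.OSLabelledPieces
import HarnessLib

/-!
# One continuation step of OS II with spatial labels: explicit bounds for the piece functions

Topic `Literature/MathematicalPhysics/QuantumFieldTheory`; support file (all proved; one
`Prop`-valued structure; no named facts) for the discharge of (A1) `OS1975_exists_timeContinuation`.
This is `OSContinuationBounds` with the spatial variables restored as labels (see
`OSLabelledPieces`): Osterwalder–Schrader II (Comm. Math. Phys. 42 (1975)), Ch. VI.2, (6.22), the
Schwarz inequality `|S_k(ζ̄', z, ζ)| ≤ ‖Ψₙ(x', ζ')‖ ‖Ψₘ(x, ζ)‖` for the labelled piece functions, in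
the growth class "`|S k c Z| ≤ C (∏ᵢ (|Zᵢ| + |Zᵢ|⁻¹))^p` on the argument region of every compact part
of the base, **uniformly over the good labels** `c`" (OS: uniformly over the spatial configurations in
a ball, (6.19)–(6.20)):

* `IsOSLabelledGrowth N good S Cfun pfun` — the growth hypothesis at level `N`;
* `norm_vec_sq_leL` — norms of the labelled vectors through the growth at the doubled label;
* `norm_pieceFun_leL` — `‖F Z‖ ≤ pieceConst · Π(Z)^{pieceExp}` on the argument region of a compact
  part of the piece, with the *same* explicit constants `pieceConst`, `pieceExp` of
  `OSContinuationBounds` (they do not depend on the label).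

## References

* K. Osterwalder, R. Schrader, *Axioms for Euclidean Green's functions II*, Comm. Math. Phys. 42
  (1975) 281–305, Ch. VI.2 (6.19)–(6.23). [OsterwalderSchraderCMP1975]
-/

noncomputable section

open Metric Set Filter Complex
open scoped Topology ComplexConjugate InnerProductSpace

namespace Literature.MathematicalPhysics.QuantumFieldTheory.OSEnvelope

open Literature.Analysis.Complex Literature.MathematicalPhysics.QuantumFieldTheory

variable {E : Type*} {H : Type*} [NormedAddCommGroup H] [InnerProductSpace ℂ H]

/-! ### The growth class, uniform over the good labels -/

/-- **Labelled level-`N` growth, uniform over the good labels**: for every `k`, every good label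
`c` and every compact `K ⊆ c_k^{(N+1)}`, on the argument region of `K`,
`‖S k c Z‖ ≤ Cfun k K · Π(Z)^{pfun k}` (OS II (6.19)–(6.20): the temperedness class in the variables
`ζ`, uniformly in the spatial variables of a bounded set). [cite: OsterwalderSchraderCMP1975, Ch. VI.2 (6.19)–(6.20), (6.28)] -/
structure IsOSLabelledGrowth (N : ℕ) (good : (k : ℕ) → (Fin (k + 1) → E) → Prop)
    (S : (k : ℕ) → (Fin (k + 1) → E) → (Fin k → ℂ) → ℂ) (Cfun : (k : ℕ) → Set (Fin k → ℝ) → ℝ)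
    (pfun : ℕ → ℕ) : Prop where
  bound : ∀ (k : ℕ) (c : Fin (k + 1) → E), good k c → ∀ K : Set (Fin k → ℝ), K ⊆ osBaseC (N + 1) k →
    IsCompact K → ∀ Z ∈ argRegion K, ‖S k c Z‖ ≤ Cfun k K * gFactor Z ^ pfun k

/-! ### The bound -/

section Bound

variable {T : ℂ → H →L[ℂ] H} {CT : ℝ} {N : ℕ} {good : (k : ℕ) → (Fin (k + 1) → E) → Prop}
  {S : (k : ℕ) → (Fin (k + 1) → E) → (Fin k → ℂ) → ℂ}
  {Cfun : (k : ℕ) → Set (Fin k → ℝ) → ℝ} {pfun : ℕ → ℕ}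

omit [InnerProductSpace ℂ H] in
/-- **Norms of the labelled vectors through the level-`N` growth at the doubled label**: for `ζ` in
the argument region of `d_m^{(N+1)}` with arguments in `K₁`,
`‖Ψ m a x ζ‖² ≤ Cfun (2m+1) (dEmbed '' K₁) · Π(θζ, 2x, ζ)^{p}`. [cite: OsterwalderSchraderCMP1975, Ch. VI.2 (6.22)] -/
theorem norm_vec_sq_leL (hG : IsOSLabelledGrowth N good S Cfun pfun)
    {Ψ : (m : ℕ) → (Fin (m + 1) → E) → ℝ → (Fin m → ℂ) → H} {m : ℕ} {a : Fin (m + 1) → E}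
    (ha : good (m + 1 + m) (dblPos a))
    (hnorm : ∀ x : ℝ, 0 < x → ∀ ζ ∈ argRegion (osBaseD (N + 1) m),
      ‖Ψ m a x ζ‖ ^ 2 = (S (m + 1 + m) (dblPos a) (cDiagEmbed (star ζ) ((2 * x : ℝ) : ℂ) ζ)).re)
    {K₁ : Set (Fin m → ℝ)} (hK₁ : K₁ ⊆ osBaseD (N + 1) m) (hK₁c : IsCompact K₁)
    {x : ℝ} (hx : 0 < x) {w : Fin m → ℂ} (hw : ∀ i, 0 < (w i).re) (hwK : (fun i => (w i).arg) ∈ K₁) :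
    ‖Ψ m a x w‖ ^ 2 ≤ max (Cfun (m + 1 + m) (dEmbed '' K₁)) 0 *
      gFactor (cDiagEmbed (star w) ((2 * x : ℝ) : ℂ) w) ^ pfun (m + 1 + m) := by
  have hmem : w ∈ argRegion (osBaseD (N + 1) m) := ⟨hw, hK₁ hwK⟩
  rw [hnorm x hx w hmem]
  have hK : dEmbed '' K₁ ⊆ osBaseC (N + 1) (m + 1 + m) := by
    rintro _ ⟨u, hu, rfl⟩; exact (mem_osBaseD_iff _).1 (hK₁ hu)
  have hKc : IsCompact (dEmbed '' K₁) := hK₁c.image (continuous_dEmbed _)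
  have hP := cDiagEmbed_star_mem_argRegion hw hwK (by positivity : 0 < 2 * x)
  have h := hG.bound (m + 1 + m) _ ha _ hK hKc _ hP
  exact (Complex.re_le_norm _).trans (h.trans (mul_le_mul_of_nonneg_right (le_max_left _ _)
    (pow_nonneg (gFactor_nonneg _) _)))

/-- **The explicit bound for the labelled piece functions** (OS II (6.22)–(6.23)): on the argument
region of a compact part `Kp` of the piece at position `p` with free argument `≤ θ₀ < π/2`,
`‖F Z‖ ≤ pieceConst · Π(Z)^{pieceExp}`, for every good label `c` of a class closed under the
doubling of the parts. [cite: OsterwalderSchraderCMP1975, Ch. VI.2 (6.22)–(6.23)] -/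
theorem norm_pieceFun_leL (hT : IsOSSemigroup T CT) (hgood : IsOSLabelSet good)
    (hG : IsOSLabelledGrowth N good S Cfun pfun) {G : (m : ℕ) → (Fin (m + 1) → E) → Prop}
    (hGgood : ∀ (m : ℕ) (a : Fin (m + 1) → E), good (m + 1 + m) (dblPos a) → G m a)
    {Ψ : (m : ℕ) → (Fin (m + 1) → E) → ℝ → (Fin m → ℂ) → H}
    (hnorm : ∀ (m : ℕ) (a : Fin (m + 1) → E), G m a → ∀ x : ℝ, 0 < x → ∀ ζ ∈ argRegion (osBaseD (N + 1) m),
      ‖Ψ m a x ζ‖ ^ 2 = (S (m + 1 + m) (dblPos a) (cDiagEmbed (star ζ) ((2 * x : ℝ) : ℂ) ζ)).re)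
    {k : ℕ} {c : Fin (k + 1) → E} (hc : good k c) {p : Fin k} {F : (Fin k → ℂ) → ℂ}
    (hF : ∀ Z ∈ argRegion (osPiece (N + 1) k p), ∀ (x' x : ℝ) (τ : ℂ), 0 < x' → 0 < x → 0 ≤ τ.re →
      (x' : ℂ) + x + τ = Z p →
        F Z = ⟪Ψ p (posRevLeft c p) x' (star (blockRevLeft Z p)),
          T τ (Ψ (k - 1 - p) (posRight c p) x (blockRight Z p))⟫_ℂ)
    {Kp : Set (Fin k → ℝ)} (hKc : IsCompact Kp) (hKp : Kp ⊆ osPiece (N + 1) k p)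
    {θ₀ : ℝ} (hθ₀ : θ₀ < Real.pi / 2) (hθKp : ∀ v ∈ Kp, |v p| ≤ θ₀)
    {Z : Fin k → ℂ} (hZ : Z ∈ argRegion Kp) :
    ‖F Z‖ ≤ pieceConst CT Cfun pfun k p Kp (Real.cos θ₀) * gFactor Z ^ pieceExp pfun k p := by
  -- the labels of the two parts are good after doubling
  have hl : good (p + 1 + p) (dblPos (posRevLeft c p)) := hgood.left k c p hc
  have hr : good (k - 1 - p + 1 + (k - 1 - p)) (dblPos (posRight c p)) := hgood.right k c p hc
  -- the free entry
  set ζ : ℂ := Z p with hζ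
  have hZne : ∀ i, Z i ≠ 0 := fun i h => by have := hZ.1 i; rw [h] at this; simp at this
  have hζre : 0 < ζ.re := hZ.1 p
  have hc₀ : 0 < Real.cos θ₀ := by
    have hθ0 : 0 ≤ θ₀ := by
      rcases Kp.eq_empty_or_nonempty with h | ⟨v, hv⟩
      · exact absurd hZ.2 (by rw [h]; exact notMem_empty _)
      · exact (abs_nonneg _).trans (hθKp v hv)
    exact Real.cos_pos_of_mem_Ioo ⟨by linarith [Real.pi_pos], hθ₀⟩
  have hre : ‖ζ‖ * Real.cos θ₀ ≤ ζ.re :=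
    norm_mul_cos_le_re_of_abs_arg_le hθ₀.le (hθKp _ hZ.2)
  -- the split
  set x : ℝ := ζ.re / 4 with hx
  have hx0 : 0 < x := by positivity
  set τ : ℂ := ζ - ((ζ.re / 2 : ℝ) : ℂ) with hτ
  have hτre : 0 < τ.re := by simp only [hτ, Complex.sub_re, Complex.ofReal_re]; linarith
  have hsum : (x : ℂ) + x + τ = ζ := by simp only [hx, hτ]; push_cast; ring
  have hZpiece : Z ∈ argRegion (osPiece (N + 1) k p) := ⟨hZ.1, hKp hZ.2⟩
  rw [hF Z hZpiece x x τ hx0 hx0 hτre.le hsum]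
  -- Schwarz
  set w : Fin p → ℂ := star (blockRevLeft Z p) with hw
  set z : Fin (k - 1 - p) → ℂ := blockRight Z p with hz
  have hw_re : ∀ i, 0 < (w i).re := re_star_blockRevLeft_pos hZ.1 p
  have hz_re : ∀ j, 0 < (z j).re := re_blockRight_pos hZ.1 p
  have hwK : (fun i => (w i).arg) ∈ (fun v => splitLeft v p) '' Kp := by
    rw [hw, arg_star_blockRevLeft hZ.1 p]; exact mem_image_of_mem _ hZ.2
  have hzK : (fun j => (z j).arg) ∈ (fun v => splitRight v p) '' Kp := by
    rw [hz, arg_blockRight]; exact mem_image_of_mem _ hZ.2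
  have hK₁ : (fun v => splitLeft v p) '' Kp ⊆ osBaseD (N + 1) p := by
    rintro _ ⟨v, hv, rfl⟩; exact (hKp hv).1
  have hK₂ : (fun v => splitRight v p) '' Kp ⊆ osBaseD (N + 1) (k - 1 - p) := by
    rintro _ ⟨v, hv, rfl⟩; exact (hKp hv).2.2
  set a : ℝ := ‖Ψ p (posRevLeft c p) x w‖ with ha
  set b : ℝ := ‖Ψ (k - 1 - p) (posRight c p) x z‖ with hb
  have hSchwarz : ‖⟪Ψ p (posRevLeft c p) x w, T τ (Ψ (k - 1 - p) (posRight c p) x z)⟫_ℂ‖ ≤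
      max CT 0 * (a * b) := by
    calc ‖⟪Ψ p (posRevLeft c p) x w, T τ (Ψ (k - 1 - p) (posRight c p) x z)⟫_ℂ‖
        ≤ ‖Ψ p (posRevLeft c p) x w‖ * ‖T τ (Ψ (k - 1 - p) (posRight c p) x z)‖ := norm_inner_le_norm _ _
      _ ≤ ‖Ψ p (posRevLeft c p) x w‖ * (‖T τ‖ * ‖Ψ (k - 1 - p) (posRight c p) x z‖) :=
          mul_le_mul_of_nonneg_left ((T τ).le_opNorm _) (norm_nonneg _)
      _ ≤ a * (max CT 0 * b) := by
          refine mul_le_mul_of_nonneg_left (mul_le_mul_of_nonneg_right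
            ((hT.norm_le τ hτre).trans (le_max_left _ _)) (norm_nonneg _)) (norm_nonneg _)
      _ = max CT 0 * (a * b) := by ring
  -- the two norms through the level-`N` growth at the doubled labels
  have h2x : 2 * x = ζ.re / 2 := by rw [hx]; ring
  have hwZ : ∀ j, ∃ i, ‖w j‖ = ‖Z i‖ := fun j =>
    ⟨⟨p - 1 - j, by have := p.2; omega⟩, by simp [hw, Pi.star_apply]⟩
  have hzZ : ∀ j, ∃ i, ‖z j‖ = ‖Z i‖ := fun j => ⟨⟨p + 1 + j, by have := j.2; omega⟩, by simp [hz]⟩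
  have hζZ : ∃ i, ζ = Z i := ⟨p, rfl⟩
  set A : ℝ := 1 + 2 / Real.cos θ₀ with hA
  have hA1 : 1 ≤ A := by
    have : 0 ≤ 2 / Real.cos θ₀ := by positivity
    rw [hA]; linarith
  set e₁ : ℕ := (p + 1 + p) * pfun (p + 1 + p) with he₁
  set e₂ : ℕ := (k - 1 - p + 1 + (k - 1 - p)) * pfun (k - 1 - p + 1 + (k - 1 - p)) with he₂
  set C₁ : ℝ := max (Cfun (p + 1 + p) (leftGramSet p Kp)) 0 with hC₁
  set C₂ : ℝ := max (Cfun (k - 1 - p + 1 + (k - 1 - p)) (rightGramSet p Kp)) 0 with hC₂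
  have ha2 : a ^ 2 ≤ C₁ * (A * gFactor Z) ^ e₁ := by
    have h := norm_vec_sq_leL hG hl (hnorm _ _ (hGgood _ _ hl)) hK₁ (hKc.image (continuous_splitLeft p))
      hx0 hw_re hwK
    refine h.trans ?_
    rw [he₁, pow_mul]
    refine mul_le_mul_of_nonneg_left (pow_le_pow_left₀ (gFactor_nonneg _) ?_ _) (le_max_right _ _)
    rw [h2x]
    exact gFactor_cDiagEmbed_le hZne hwZ hζZ hc₀ hre hζre
  have hb2 : b ^ 2 ≤ C₂ * (A * gFactor Z) ^ e₂ := by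
    have h := norm_vec_sq_leL hG hr (hnorm _ _ (hGgood _ _ hr)) hK₂ (hKc.image (continuous_splitRight p))
      hx0 hz_re hzK
    refine h.trans ?_
    rw [he₂, pow_mul]
    refine mul_le_mul_of_nonneg_left (pow_le_pow_left₀ (gFactor_nonneg _) ?_ _) (le_max_right _ _)
    rw [h2x]
    exact gFactor_cDiagEmbed_le hZne hzZ hζZ hc₀ hre hζre
  -- assemble: `ab ≤ (a² + b²)/2`, raise exponents to the max
  have hab : a * b ≤ (a ^ 2 + b ^ 2) / 2 := by nlinarith [sq_nonneg (a - b)]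
  have hpow₁ : (A * gFactor Z) ^ e₁ ≤ A ^ e₁ * gFactor Z ^ pieceExp pfun k p := by
    rw [mul_pow]
    exact mul_le_mul_of_nonneg_left (gFactor_pow_le_pow hZne (le_max_left _ _)) (by positivity)
  have hpow₂ : (A * gFactor Z) ^ e₂ ≤ A ^ e₂ * gFactor Z ^ pieceExp pfun k p := by
    rw [mul_pow]
    exact mul_le_mul_of_nonneg_left (gFactor_pow_le_pow hZne (le_max_right _ _)) (by positivity)
  have hC₁0 : 0 ≤ C₁ := le_max_right _ _
  have hC₂0 : 0 ≤ C₂ := le_max_right _ _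
  calc ‖⟪Ψ p (posRevLeft c p) x w, T τ (Ψ (k - 1 - p) (posRight c p) x z)⟫_ℂ‖ ≤ max CT 0 * (a * b) := hSchwarz
    _ ≤ max CT 0 * ((a ^ 2 + b ^ 2) / 2) := mul_le_mul_of_nonneg_left hab (le_max_right _ _)
    _ ≤ max CT 0 * ((C₁ * (A ^ e₁ * gFactor Z ^ pieceExp pfun k p) +
          C₂ * (A ^ e₂ * gFactor Z ^ pieceExp pfun k p)) / 2) := by
        gcongr
        · exact ha2.trans (mul_le_mul_of_nonneg_left hpow₁ hC₁0)
        · exact hb2.trans (mul_le_mul_of_nonneg_left hpow₂ hC₂0)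
    _ = pieceConst CT Cfun pfun k p Kp (Real.cos θ₀) * gFactor Z ^ pieceExp pfun k p := by
        simp only [pieceConst, hC₁, hC₂, hA, he₁, he₂]
        ring

end Bound

end Literature.MathematicalPhysics.QuantumFieldTheory.OSEnvelope
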